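import Summits.CriticalPhenomena.CardyFormulaZ2.Theorems.CardyIKTransportIKMixedBoxCrossingTransportStubCylPlaneCut

/-!
# Stub `stub_cylPlane` (line `defect-closure-exploration`, crux `IKMixedBoxCrossing`, stmt-CriticalPhenomena-5911) —
# helper 3: the OFF-BAND SUM and the comparison of the slab law on a band with the planar free box law

Support file (`--supports stmt-CriticalPhenomena-5911`) for the registered stub `stub_cylPlane : CylPlane`, continuing
helper 2 (`…TransportStubCylPlaneCut.lean`: the cut `splitEquiv`, `cylWeight_glue`).

* `pathSum_eq`: summing the product of the row transfer weights along a path over its inner nodes gives a power of the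
  transfer matrix `K τ` of helper 1.
* `sum_off`: for a fixed band part, the total slab weight of its gluings is the box weight of the band times the
  `(d'+1)`-step row kernel between the top and the bottom row of the band (flags first, `Fintype.prod_sum`; then the
  off-band rows are the inner nodes of a path from row `h` to row `0` through the seam).
* `cylProb_bandQ_le`: by the `L∞` mixing of the row kernel (`K_pow_ratio`, factor `5/4` on the numerator and on the
  partition function), the slab probability of any event of the band is at most `2 ×` its planar free box probability.
-/

noncomputable section

namespace Summit.CriticalPhenomena.CardyFormulaZ2.Cruxes.IKMixedBoxCrossing.DefectClosureExploration

open scoped BigOperators Classical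
open Finset
open Summit.CriticalPhenomena.CardyFormulaZ2.Theorems.IKLinearTransport.PinnedDiagramExchange (faceWeight)

namespace CylPlane

variable {w L h d' : ℕ}

/-- The rows of the off-band path: row `h` of the band (`i = 0`), the `d'` off-band rows, row `0` of the band
(`i = d' + 1`). -/
def node (u v : Row w) (o : Fin d' → Row w) (i : Fin (d' + 2)) : Row w :=
  if _h0 : i.val = 0 then u else if _hi : i.val ≤ d' then o ⟨i.val - 1, by omega⟩ else v

/-- The first node. -/
theorem node_eq_top {u v : Row w} {o : Fin d' → Row w} (i : Fin (d' + 2)) (hi : i.val = 0) : node u v o i = u := by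
  simp [node, hi]

/-- The middle nodes. -/
theorem node_eq_mid {u v : Row w} {o : Fin d' → Row w} (i : Fin (d' + 2)) (k : Fin d') (hk : i.val = k.val + 1) :
    node u v o i = o k := by
  simp only [node]
  rw [dif_neg (by omega), dif_pos (by omega)]
  exact congrArg o (Fin.ext (by simp only; omega))

/-- The last node. -/
theorem node_eq_bot {u v : Row w} {o : Fin d' → Row w} (i : Fin (d' + 2)) (hi : i.val = d' + 1) : node u v o i = v := by
  simp only [node]
  rw [dif_neg (by omega), dif_neg (by omega)]

/-- Shifting the path by one node. -/
theorem node_cons_succ (u m v : Row w) (o : Fin d' → Row w) (i : Fin (d' + 2)) :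
    node u v (Fin.cons m o : Fin (d' + 1) → Row w) i.succ = node m v o i := by
  by_cases h0 : i.val = 0
  · rw [node_eq_top i h0, node_eq_mid (d' := d' + 1) i.succ 0 (by simp [h0])]
    rfl
  · by_cases h1 : i.val ≤ d'
    · obtain ⟨k, hk⟩ : ∃ k : ℕ, i.val = k + 1 := ⟨i.val - 1, by omega⟩
      rw [node_eq_mid i ⟨k, by omega⟩ hk, node_eq_mid (d' := d' + 1) i.succ ⟨k + 1, by omega⟩ (by simp [hk])]
      exact Fin.cons_succ (α := fun _ => Row w) m o ⟨k, by omega⟩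
    · rw [node_eq_bot i (by omega), node_eq_bot (d' := d' + 1) i.succ (by simp; omega)]

/-- **Path sums are powers of the transfer matrix**: summing the product of the row transfer weights along the
path over its `d'` inner nodes gives `(K τ ^ (d'+1)) u v`. -/
theorem pathSum_eq (τ : Fin w → Bool) : ∀ (d' : ℕ) (u v : Row w),
    ∑ o : Fin d' → Row w, ∏ i : Fin (d' + 1), g τ (rxor (node u v o i.castSucc) (node u v o i.succ)) =
      (K τ ^ (d' + 1)) u v
  | 0, u, v => by
    rw [Fintype.sum_unique, Fin.prod_univ_one, pow_one, node_eq_top _ rfl, node_eq_bot _ rfl]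
    rfl
  | d' + 1, u, v => by
    rw [← (Fin.consEquiv fun _ : Fin (d' + 1) => Row w).sum_comp, Fintype.sum_prod_type, pow_succ',
      Matrix.mul_apply]
    refine Finset.sum_congr rfl fun m _ => ?_
    rw [← pathSum_eq τ d' m v, Finset.mul_sum]
    refine Finset.sum_congr rfl fun o _ => ?_
    have e : (Fin.consEquiv (fun _ : Fin (d' + 1) => Row w)) (m, o) = (Fin.cons m o : Fin (d' + 1) → Row w) := rfl
    rw [e, Fin.prod_univ_succ]
    have h1 : K τ u m = g τ (rxor (node u v (Fin.cons m o : Fin (d' + 1) → Row w) (0 : Fin (d' + 2)).castSucc)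
        (node u v (Fin.cons m o : Fin (d' + 1) → Row w) (0 : Fin (d' + 2)).succ)) := by
      rw [Fin.castSucc_zero, node_eq_top _ rfl, Fin.succ_zero_eq_one,
        show (1 : Fin (d' + 3)) = (0 : Fin (d' + 2)).succ from rfl, node_cons_succ, node_eq_top _ rfl]
      rfl
    rw [h1]
    exact congrArg _ (Finset.prod_congr rfl fun i _ => by rw [← Fin.succ_castSucc, node_cons_succ, node_cons_succ])

/-- The parity of a face is the increment, across its column, of the xor of its two rows. -/
theorem cylFaceOdd_eq_cj (col : Fin (w + 1) × ZMod L → Bool) (j : Fin w) (r : ZMod L) :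
    cylFaceOdd col (j, r) = cj (rxor (fun c1 => col (c1, r)) (fun c1 => col (c1, r + 1))) j := by
  simp only [cylFaceOdd, cj, rxor]
  cases col (j.castSucc, r) <;> cases col (j.succ, r) <;> cases col (j.castSucc, r + 1) <;>
    cases col (j.succ, r + 1) <;> rfl

section OffSum

variable [NeZero L] (hL : L = h + 1 + d') (τ : Fin w → Bool) (q : Q w h)

/-- Row `h + i` of a glued configuration is the `i`-th node of the off-band path. -/
theorem glue_row (o : Off w L h d') (i : Fin (d' + 1)) (c1 : Fin (w + 1)) :
    glueCol hL q o.1 (c1, ((h + (i : ℕ) : ℕ) : ZMod L)) = node (topRow q) (botRow q) o.1 i.castSucc c1 := by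
  have hv : (((h + (i : ℕ) : ℕ)) : ZMod L).val = h + i := ZMod.val_cast_of_lt (by omega)
  rcases Nat.eq_zero_or_pos i.val with h0 | hpos
  · rw [glue_fst_of_le hL q o c1 _ (Fin.last h) (by rw [hv, h0]; simp), node_eq_top _ (by simp [h0])]
    rfl
  · rw [glue_fst_of_gt hL q o c1 _ ⟨i.val - 1, by omega⟩ (by rw [hv]; simp only; omega),
      node_eq_mid i.castSucc ⟨i.val - 1, by omega⟩ (by simp only [Fin.val_castSucc]; omega)]

/-- Row `h + i + 1` of a glued configuration is the `(i+1)`-st node of the off-band path (row `0` at the seam). -/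
theorem glue_row_succ (o : Off w L h d') (i : Fin (d' + 1)) (c1 : Fin (w + 1)) :
    glueCol hL q o.1 (c1, ((h + (i : ℕ) : ℕ) : ZMod L) + 1) = node (topRow q) (botRow q) o.1 i.succ c1 := by
  have hv : (((h + (i : ℕ) : ℕ)) : ZMod L).val = h + i := ZMod.val_cast_of_lt (by omega)
  by_cases hlast : i.val = d'
  · rw [add_one_eq_zero _ (by rw [hv]; omega), glue_fst_of_le hL q o c1 0 0 (by simp),
      node_eq_bot _ (by simp [hlast])]
    rfl
  · have hv1 : ((((h + (i : ℕ) : ℕ)) : ZMod L) + 1).val = h + i + 1 := by rw [val_add_one _ (by omega), hv]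
    rw [glue_fst_of_gt hL q o c1 _ ⟨i.val, by omega⟩ (by rw [hv1]; simp only; omega),
      node_eq_mid i.succ ⟨i.val, by omega⟩ (by simp)]

/-- The colour weight of the off-band faces of a glued configuration is the product of the row transfer
weights along the off-band path. -/
theorem prod_off (o : Off w L h d') :
    ∏ f : {f : Fin w × ZMod L // ¬ f.2.val < h}, gf (τ f.1.1) (cylFaceOdd (glueCol hL q o.1) f.1) =
      ∏ i : Fin (d' + 1), g τ (rxor (node (topRow q) (botRow q) o.1 i.castSucc)
        (node (topRow q) (botRow q) o.1 i.succ)) := by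
  rw [← Fintype.prod_equiv (offFaceEquiv hL).symm (fun p : Fin w × Fin (d' + 1) => gf (τ p.1)
      (cj (rxor (node (topRow q) (botRow q) o.1 p.2.castSucc) (node (topRow q) (botRow q) o.1 p.2.succ)) p.1))
      _ (fun p => ?_)]
  · rw [Fintype.prod_prod_type, Finset.prod_comm]
    rfl
  · show gf (τ p.1) _ = gf (τ p.1) (cylFaceOdd (glueCol hL q o.1) (p.1, ((h + (p.2 : ℕ) : ℕ) : ZMod L)))
    rw [cylFaceOdd_eq_cj]
    congr 2
    exact (congrArg₂ rxor (funext fun c1 => glue_row hL q o p.2 c1)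
      (funext fun c1 => glue_row_succ hL q o p.2 c1)).symm

/-- **The off-band sum**: for a fixed band part, the total slab weight of its gluings is the box weight of the band
times the `(d'+1)`-step row kernel between the top and the bottom row of the band. -/
theorem sum_off : ∑ o : Off w L h d', cylWeight w L τ (glue hL q o) =
    qWt τ q * (K τ ^ (d' + 1)) (topRow q) (botRow q) := by
  simp_rw [cylWeight_glue hL τ q]
  rw [← Finset.mul_sum, Fintype.sum_prod_type, ← pathSum_eq τ d' (topRow q) (botRow q)]
  congr 1
  refine Finset.sum_congr rfl fun o1 _ => ?_
  rw [← prod_off hL τ q (o1, fun _ => false)]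
  -- flags first: `Fintype.prod_sum` (`∏ f, ∑ b, F f b = ∑ φ, ∏ f, F f (φ f)`) read from right to left
  rw [← Fintype.prod_sum fun (f : {f : Fin w × ZMod L // ¬ f.2.val < h}) (b : Bool) =>
    faceWeight (τ f.1.1) (cylFaceOdd (glueCol hL q o1) f.1) b]
  exact Finset.prod_congr rfl fun f _ => sum_faceWeight _ _

end OffSum

/-! ## §5 The slab law on a band versus the planar free box law -/

/-- **CYLINDER versus PLANE on a band.** For `L = h + 1 + d'` with `d' ≥ 2w + 1`, the slab probability of an event read on
the band of rows `0 … h` is at most twice its planar free box probability: through the cut both the numerator and the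
partition function are sums over band parts `q` of `qWt τ q × (K τ ^ (d'+1)) (top q) (bot q)` (`sum_off`), and the kernel
entries are within the factor `5/4` of a reference value (`K_pow_ratio`), `(5/4)² ≤ 2`. -/
theorem cylProb_bandQ_le [NeZero L] (hL : L = h + 1 + d') (hd : 2 * w + 1 ≤ d') (τ : Fin w → Bool)
    (E : Set (Q w h)) : cylProb w L τ (bandQ L h ⁻¹' E) ≤ 2 * qProb τ E := by
  have hnum : (∑ x : CylCfg w L, if x ∈ bandQ L h ⁻¹' E then cylWeight w L τ x else 0) =
      ∑ q : Q w h, if q ∈ E then qWt τ q * (K τ ^ (d' + 1)) (topRow q) (botRow q) else 0 := by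
    rw [← (splitEquiv hL).symm.sum_comp, Fintype.sum_prod_type]
    refine Finset.sum_congr rfl fun q _ => ?_
    have hmem : ∀ o : Off w L h d', (glue hL q o ∈ bandQ L h ⁻¹' E) = (q ∈ E) := fun o => by
      rw [Set.mem_preimage, bandQ_glue]
    have e : ∀ o : Off w L h d', (splitEquiv hL).symm (q, o) = glue hL q o := fun o => rfl
    simp only [e, hmem]
    split_ifs with hq
    · exact sum_off hL τ q
    · simp
  have hden : cylZ w L τ = ∑ q : Q w h, qWt τ q * (K τ ^ (d' + 1)) (topRow q) (botRow q) := by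
    unfold cylZ
    rw [← (splitEquiv hL).symm.sum_comp, Fintype.sum_prod_type]
    exact Finset.sum_congr rfl fun q _ => sum_off hL τ q
  set m := (K τ ^ (d' + 1)) (fun _ => false) (fun _ => false) with hm
  have hK : ∀ u v : Row w, (K τ ^ (d' + 1)) u v ≤ 5 / 4 * m ∧ m ≤ 5 / 4 * (K τ ^ (d' + 1)) u v := fun u v =>
    ⟨(K_pow_ratio τ (d' + 1) (by omega) u v _ _).2, (K_pow_ratio τ (d' + 1) (by omega) _ _ u v).2⟩
  have hm0 : 0 < m := (K_pow_ratio τ (d' + 1) (by omega) _ _ (fun _ => false) (fun _ => false)).1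
  set NE := ∑ q : Q w h, if q ∈ E then qWt τ q else 0 with hNE
  have hNE0 : 0 ≤ NE := Finset.sum_nonneg fun q _ => by split_ifs; exacts [qWt_nonneg τ q, le_rfl]
  have hN : (∑ q : Q w h, if q ∈ E then qWt τ q * (K τ ^ (d' + 1)) (topRow q) (botRow q) else 0) ≤
      5 / 4 * m * NE := by
    rw [hNE, Finset.mul_sum]
    refine Finset.sum_le_sum fun q _ => ?_
    split_ifs
    · calc qWt τ q * _ ≤ qWt τ q * (5 / 4 * m) := mul_le_mul_of_nonneg_left (hK _ _).1 (qWt_nonneg τ q)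
        _ = 5 / 4 * m * qWt τ q := by ring
    · simp
  have hZ : 4 / 5 * m * qZ τ h ≤ ∑ q : Q w h, qWt τ q * (K τ ^ (d' + 1)) (topRow q) (botRow q) := by
    unfold qZ
    rw [Finset.mul_sum]
    refine Finset.sum_le_sum fun q _ => ?_
    calc 4 / 5 * m * qWt τ q = qWt τ q * (4 / 5 * m) := by ring
      _ ≤ _ := mul_le_mul_of_nonneg_left (by linarith [(hK (topRow q) (botRow q)).2]) (qWt_nonneg τ q)
  have hqZ := qZ_pos (w := w) τ h
  have hZ0 : 0 < 4 / 5 * m * qZ τ h := mul_pos (mul_pos (by norm_num) hm0) hqZ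
  unfold cylProb qProb
  rw [hnum, hden, div_le_iff₀ (lt_of_lt_of_le hZ0 hZ), ← hNE]
  refine hN.trans ?_
  have step : 5 / 4 * m * NE ≤ 2 * (NE / qZ τ h) * (4 / 5 * m * qZ τ h) := by
    clear_value NE m
    rw [show 2 * (NE / qZ τ h) * (4 / 5 * m * qZ τ h) = 8 / 5 * m * NE by field_simp; ring]
    nlinarith [mul_nonneg hm0.le hNE0]
  exact step.trans (mul_le_mul_of_nonneg_left hZ (mul_nonneg zero_le_two (div_nonneg hNE0 hqZ.le)))

end CylPlane

/-- **Registered helper `cylPlane_cylProb_band_le`** (line `defect-closure-exploration`, stub `stub_cylPlane`, step (iii)):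
CYLINDER versus PLANE — for `L = h + 1 + d'`, `d' ≥ 2w + 1`, the slab probability of an event read on the band of rows
`0 … h` is at most twice its planar free box probability. -/
theorem cylPlane_cylProb_band_le : ∀ {w L h d' : ℕ} [NeZero L] (hL : L = h + 1 + d') (hd : 2 * w + 1 ≤ d')
    (τ : Fin w → Bool) (E : Set (CylPlane.Q w h)),
    cylProb w L τ (CylPlane.bandQ L h ⁻¹' E) ≤ 2 * CylPlane.qProb τ E :=
  fun hL hd τ E => CylPlane.cylProb_bandQ_le hL hd τ E

end Summit.CriticalPhenomena.CardyFormulaZ2.Cruxes.IKMixedBoxCrossing.DefectClosureExploration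

end
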